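import Summits.ResolutionOfSingularities.ResolutionOfSingularities.Theorems.PurelyInseparableDim4PureLeafInertSquare
import HarnessLib
import HarnessLib.Audit.Tags

/-!
# Purely inseparable fourfolds — INERT SQUARE, any fresh variable: the unit leaves `1·1·1` and `3·1·1` with ONE exponent replaced by `2c` win for every `c` ‖ K
# (cell res-dim4-pi; brick (δ) «unit leaves x^a(1+x₀)», UNIFORM families) [OURS · counted 0 · a theorem about OUR coordinate-centre frame v4, not about resolution]

Width seat `res-dim4-p-10` (g5).  `…PureLeafInertSquare` proves `InertSquare.stateWins_unitLeaf_111_sq` / `_311_sq` (the fresh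
variable is `x₃`).  The frame is equivariant under renamings (`PureLeafGlobalWin.stateWins_rename`) and the game reads `F` only
(`WinCertF.stateWins_rebook`); a renaming fixing `x₀` maps a unit leaf `x^a(1+x₀)` to the unit leaf of the permuted exponent
vector.  **`stateWins_unitLeaf_of_perm`** is that transport (general, reusable); instances: the unit leaves with exponent vectors
`(1, 2c, 1, 1)`, `(1, 1, 2c, 1)`, `(3, 2c, 1, 1)`, `(3, 1, 2c, 1)` win for every `c` and every booking (census: 1211, 1121, 3211, 3121).

Riders: `𝔽₂`-rational replies; the PLAIN coordinate game of OUR frame v4 (`StateWins 2`), not MODE 1h, not CJS; nothing here proves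
F4-C(2,2), `Terminates1h 2 2` or resolution of singularities in dimension ≥ 4 / characteristic `p`; counted 0; AI kernel work, weaker
than expert review. bears_on: LADDER-RESOLUTION:D157-DOOR2 (res-dim4-pi · brick (δ) · unit-leaf row, uniform theorem).
Supports stmt-ResolutionOfSingularities-16155 (helper).
-/

set_option linter.dupNamespace false

open MvPolynomial Finset

noncomputable section

namespace Summit.ResolutionOfSingularities.ResolutionOfSingularities.Theorems.PIDim4

namespace InertSquare

open Literature.AlgebraicGeometry.Resolution

/-- **Transport of a unit-leaf win along a renaming fixing `x₀`.** If the unit leaf of the exponent vector `a ∘ e` wins for every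
booking, so does the unit leaf of `a`. [folklore] -/
theorem stateWins_unitLeaf_of_perm (e : Equiv.Perm (Fin 4)) (he0 : e 0 = 0) (a : Fin 4 → ℕ)
    (h : ∀ (r : Fin 4 →₀ ℕ) (exc : Finset (Fin 4)),
      StateWins 2 (⟨monomial (Finsupp.equivFunOnFinite.symm fun i => a (e i)) 1 * (1 + X 0), r, exc⟩ : State (ZMod 2)))
    (r : Fin 4 →₀ ℕ) (exc : Finset (Fin 4)) :
    StateWins 2 (⟨monomial (Finsupp.equivFunOnFinite.symm a) 1 * (1 + X 0), r, exc⟩ : State (ZMod 2)) := by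
  have hren := WinCertF.stateWins_rebook (PureLeafGlobalWin.stateWins_rename e 2 (h r exc)) r exc
  have hd : Finsupp.mapDomain (⇑e) (Finsupp.equivFunOnFinite.symm fun i => a (e i)) = Finsupp.equivFunOnFinite.symm a := by
    ext i
    rw [Finsupp.mapDomain_equiv_apply]
    simp
  have hF : (State.rename e (⟨monomial (Finsupp.equivFunOnFinite.symm fun i => a (e i)) 1 * (1 + X 0), r, exc⟩ :
      State (ZMod 2))).F = monomial (Finsupp.equivFunOnFinite.symm a) 1 * (1 + X 0) := by
    show rename e (monomial (Finsupp.equivFunOnFinite.symm fun i => a (e i)) 1 * (1 + X 0) : MvPolynomial (Fin 4) (ZMod 2)) = _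
    rw [map_mul, rename_monomial, hd, map_add, map_one (rename (⇑e)), rename_X, he0]
  rw [hF] at hren
  exact hren

/-- **The unit leaves `x₀x₁^{2c}x₂x₃(1+x₀)` win for every `c`**, every booking. [OURS · counted 0 · ‖ K] [folklore] -/
theorem stateWins_unitLeaf_1sq11 (c : ℕ) (r : Fin 4 →₀ ℕ) (exc : Finset (Fin 4)) :
    StateWins 2 (⟨monomial (Finsupp.equivFunOnFinite.symm ![1, 2 * c, 1, 1]) 1 * (1 + X 0), r, exc⟩ : State (ZMod 2)) :=
  stateWins_unitLeaf_of_perm (Equiv.swap 1 3) (by decide) _ (fun r exc => by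
    have hv : (fun i => (![1, 2 * c, 1, 1] : Fin 4 → ℕ) ((Equiv.swap (1 : Fin 4) 3) i)) = ![1, 1, 1, 2 * c] := by
      funext i; fin_cases i <;> simp [Equiv.swap_apply_of_ne_of_ne]
    rw [hv]
    exact Orbit111.stateWins_unitLeaf_111_sq c r exc) r exc

/-- **The unit leaves `x₀x₁x₂^{2c}x₃(1+x₀)` win for every `c`**, every booking. [OURS · counted 0 · ‖ K] [folklore] -/
theorem stateWins_unitLeaf_11sq1 (c : ℕ) (r : Fin 4 →₀ ℕ) (exc : Finset (Fin 4)) :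
    StateWins 2 (⟨monomial (Finsupp.equivFunOnFinite.symm ![1, 1, 2 * c, 1]) 1 * (1 + X 0), r, exc⟩ : State (ZMod 2)) :=
  stateWins_unitLeaf_of_perm (Equiv.swap 2 3) (by decide) _ (fun r exc => by
    have hv : (fun i => (![1, 1, 2 * c, 1] : Fin 4 → ℕ) ((Equiv.swap (2 : Fin 4) 3) i)) = ![1, 1, 1, 2 * c] := by
      funext i; fin_cases i <;> simp [Equiv.swap_apply_of_ne_of_ne]
    rw [hv]
    exact Orbit111.stateWins_unitLeaf_111_sq c r exc) r exc

/-- **The unit leaves `x₀³x₁^{2c}x₂x₃(1+x₀)` win for every `c`**, every booking. [OURS · counted 0 · ‖ K] [folklore] -/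
theorem stateWins_unitLeaf_3sq11 (c : ℕ) (r : Fin 4 →₀ ℕ) (exc : Finset (Fin 4)) :
    StateWins 2 (⟨monomial (Finsupp.equivFunOnFinite.symm ![3, 2 * c, 1, 1]) 1 * (1 + X 0), r, exc⟩ : State (ZMod 2)) :=
  stateWins_unitLeaf_of_perm (Equiv.swap 1 3) (by decide) _ (fun r exc => by
    have hv : (fun i => (![3, 2 * c, 1, 1] : Fin 4 → ℕ) ((Equiv.swap (1 : Fin 4) 3) i)) = ![3, 1, 1, 2 * c] := by
      funext i; fin_cases i <;> simp [Equiv.swap_apply_of_ne_of_ne]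
    rw [hv]
    exact Orbit311.stateWins_unitLeaf_311_sq c r exc) r exc

/-- **The unit leaves `x₀³x₁x₂^{2c}x₃(1+x₀)` win for every `c`**, every booking. [OURS · counted 0 · ‖ K] [folklore] -/
theorem stateWins_unitLeaf_31sq1 (c : ℕ) (r : Fin 4 →₀ ℕ) (exc : Finset (Fin 4)) :
    StateWins 2 (⟨monomial (Finsupp.equivFunOnFinite.symm ![3, 1, 2 * c, 1]) 1 * (1 + X 0), r, exc⟩ : State (ZMod 2)) :=
  stateWins_unitLeaf_of_perm (Equiv.swap 2 3) (by decide) _ (fun r exc => by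
    have hv : (fun i => (![3, 1, 2 * c, 1] : Fin 4 → ℕ) ((Equiv.swap (2 : Fin 4) 3) i)) = ![3, 1, 1, 2 * c] := by
      funext i; fin_cases i <;> simp [Equiv.swap_apply_of_ne_of_ne]
    rw [hv]
    exact Orbit311.stateWins_unitLeaf_311_sq c r exc) r exc

end InertSquare

end Summit.ResolutionOfSingularities.ResolutionOfSingularities.Theorems.PIDim4

end
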